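import Literature.AlgebraicGeometry.HodgeTheory.CartierCocycleChernCalculus
import Literature.AlgebraicGeometry.HodgeTheory.CartierDivisorChernClassPullback
import Literature.AlgebraicGeometry.HodgeTheory.AbelianVarietyHodgeFullnessOfUniformisation
import Literature.AlgebraicGeometry.Motives.AbelianVarietyWeilDivisor
import Literature.Geometry.Kaehler.ComplexTorusPicardTranslation
import Literature.Geometry.Kaehler.ComplexTorusHolomorphicMaps
import HarnessLib

/-!
# Analytified divisor classes of a uniformised complex abelian variety in Lange's `Pic(X)`:
# `D ∼ D' ⇒ [𝒪(D)^an] = [𝒪(D')^an]`, `t_x^* ↦ Pic.translate`, and translation-invariant classes lie in `Pic⁰`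

Layer `Literature/AlgebraicGeometry/HodgeTheory`, namespace `Literature.AlgebraicGeometry.HodgeTheory`.
Cell `hodgecm-mathlib` (D-0151), rung-0 programme on `hDel`, file J′ of the `(R1a)` road (Mumford, *Abelian
Varieties* §8 Thm. 1 «`Pic⁰(A) = φ_Θ(A)`» over `ℂ` by the analytic road): the JUNCTION between
* the algebraic / GAGA lane — Cartier divisors `D` on a `ℂ`-scheme `X` (`Motives/CartierDivisor`), their
  analytified cocycles `𝒪_X(D)^an` on an analytification `φ : M → X(ℂ)` (`cartierDivisorCocycle`,
  `cartierDivisorLineBundle`, files `AnalytificationCartierDivisor`, `CartierDivisorChernClass`,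
  `CartierCocycleChernCalculus`: `D ∼ D' ⇒ 𝒪(D)^an ≅ 𝒪(D')^an`, `𝒪(D + D')^an ≅ 𝒪(D)^an ⊗ 𝒪(D')^an`,
  `𝒪(ψ^*D)^an ≅ (ψ^an)^*𝒪(D)^an`, all as `SmoothComplexVectorBundle.AnalyticallyEquivalent` statements), and
* the Kähler lane — the Picard group `Pic(X) = H¹(Λ, H⁰(𝒪_V^*))` of a complex torus `X = V/Λ`
  (`Kaehler/ComplexTorusPicardGroup`: `Pic Φ`, `picClass`, `picZero`, `dualToPic : X̂ ≃ Pic⁰(X)`) with the action of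
  translations (`Kaehler/ComplexTorusPicardTranslation`: `Pic.translate`, `Pic.phiL`, Lemma 1.4.5).

## What is proved (theorems only; no `def`, no named fact, no instance)
* §1 `picClass_eq_of_analyticallyEquivalent` — holomorphically isomorphic rank-one cocycles (Fritzsche–Grauert
  IV §2 (C)) of two holomorphic line bundles on a torus, on arbitrary covers, have the same class in `Pic(X)`
  (Lange §1.2.1 Prop. 1.2.2–1.2.3).
* §2 `mem_picZero_of_forall_translate_eq` — a class fixed by all translations has `c₁ = 0` (Lange §1.4.2 with
  Lemma 1.4.5 and the injectivity of `X̂ → Pic⁰(X)`, Prop. 1.4.1; «`K(L) = X` iff `H = 0`»).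
* §3 for any integral `ℂ`-scheme analytified by a complex torus: `picClass_cartierDivisorLineBundle_eq_of_linEquiv`
  (`D ∼ D' ⇒ [𝒪(D)^an] = [𝒪(D')^an]`), `…_add`, `…_zero`, `…_neg` — `D ↦ [𝒪_X(D)^an]` is a homomorphism on divisor
  classes (Görtz–Wedhorn I Prop. 11.21, analytic side).
* §4 for a complex abelian variety `A` with a torus uniformisation `φ : V/Λ → A(ℂ)` compatible with the group laws
  (the record of `HodgeTheory.complexAbelianVariety_torusUniformised`, which HOLDS —
  `AbelianVarietyHodgeFullnessHolds`): `cartierDivisorLineBundle_pullback_translation` (`𝒪(t_x^*D)^an` IS the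
  pull-back of `𝒪(D)^an` along the torus translation, on the nose), `picClass_cartierDivisorLineBundle_pullback_translation`
  (`[𝒪(t_{φ t̄}^*D)^an] = t_t̄^*[𝒪(D)^an]`, Lange Lemma 1.3.4), `picClass_cartierDivisorLineBundle_weilDiv`
  (`[𝒪(D_{φ t̄})^an] = φ_{[𝒪(Θ)^an]}(t̄)` for `D_x = t_x^*Θ − Θ` = `AbelianVariety.weilDiv`: the algebraic `φ_Θ` of
  Mumford §8 is Lange's analytic `φ_L`), and the headline `picClass_cartierDivisorLineBundle_mem_picZero`: **if
  `t_x^* D ∼ D` for all `x ∈ A(ℂ)` then `[𝒪_A(D)^an] ∈ Pic⁰(X)`**, hence `= dualToPic s` for a point `s` of the dual torus.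

## What is NOT here (honest scope)
The converse junction «`[𝒪(D)^an] = [𝒪(D')^an] ⇒ D ∼ D'`» (GAGA injectivity on `Pic` for smooth projective `X/ℂ`,
i.e. `H⁰`-GAGA for invertible sheaves) is absent from the tree (cell row B1); with it, the headline upgrades to the
algebraic statement «`Pic⁰(A)(ℂ) = {t_a^*Θ − Θ}`» (Mumford §8 Thm. 1). No `HodgeModel` is used: the structure equality of
§4 is proved directly on the torus, where `(t_{φ t̄})^an = (· + t̄)` by the group-law compatibility of `φ`.

## References
* H. Lange, *Abelian Varieties over the Complex Numbers*, Grundlehren Text Editions (2023): §1.2.1 Prop. 1.2.2–1.2.3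
  (p. 21), §1.3.3 Lemma 1.3.4 (p. 31), §1.4.1 Prop. 1.4.1, §1.4.2 Lemma 1.4.5. [Lange2023AbelianVarietiesComplex]
* D. Mumford, *Abelian Varieties* (1970), §8 (the definition of `φ_L`, `K(L)`, (i)⇔(iv), Thm. 1). [MumfordAV1970]
* U. Görtz, T. Wedhorn, *Algebraic Geometry I*, 2nd ed. (2020), Section (11.9), Prop. 11.21 (p. 374), Def. 11.49 and
  Prop. 11.50 (p. 392). [GortzWedhorn2020]
* U. Görtz, T. Wedhorn, *Algebraic Geometry II* (2023), Def. 27.1 (p. 799). [GortzWedhorn2023]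
* K. Fritzsche, H. Grauert, *From Holomorphic Functions to Complex Manifolds*, GTM 213 (2002), Ch. IV §2 (C).
  [FritzscheGrauert2002]
-/

noncomputable section

open Set Function
open scoped Manifold ContDiff Topology
open Literature.AlgebraicGeometry.Motives Literature.Geometry.Kaehler Literature.Geometry.Kaehler.ComplexTorus
open Literature.NumberTheory.Transcendental

namespace Literature.AlgebraicGeometry.HodgeTheory

/-! ## §1 Holomorphically isomorphic cocycles have the same class in `Pic(X)` -/

section Bridge

variable {ι : Type*} {E : Type*} [NormedAddCommGroup E] [NormedSpace ℂ E] {Φ : (ι → ℝ) ≃L[ℝ] E}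
  [Fintype ι] [FiniteDimensional ℂ E] {κ₁ κ₂ : Type*}

/-- Unpacking an analytic equivalence of the rank-one cocycles of two holomorphic line bundles (Fritzsche–Grauert IV
§2, condition (C) for `r = 1`) into scalar units `μ_{a i}`, holomorphic and non-zero on `U¹_i ∩ U²_a`, with
`μ_{a i} g¹_{j i} = g²_{b a} μ_{b j}`. [cite: FritzscheGrauert2002, Ch. IV §2 (C)] -/
theorem exists_units_of_analyticallyEquivalent_toSmoothCocycle
    [IsManifold 𝓘(ℂ, E) ω (ComplexTorus Φ)] [IsManifold 𝓘(ℝ, E) ∞ (ComplexTorus Φ)]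
    {L₁ : HolomorphicLineBundle κ₁ E (ComplexTorus Φ)} {L₂ : HolomorphicLineBundle κ₂ E (ComplexTorus Φ)}
    (h : SmoothComplexVectorBundle.AnalyticallyEquivalent L₁.toSmoothCocycle L₂.toSmoothCocycle) :
    ∃ μ : κ₂ → κ₁ → ComplexTorus Φ → ℂ,
      (∀ a i, MDifferentiableOn 𝓘(ℂ, E) 𝓘(ℂ, ℂ) (μ a i) (L₁.baseSet i ∩ L₂.baseSet a)) ∧
      (∀ a i, ∀ x ∈ L₁.baseSet i ∩ L₂.baseSet a, μ a i x ≠ 0) ∧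
      ∀ a b i j, ∀ x ∈ (L₁.baseSet i ∩ L₁.baseSet j) ∩ (L₂.baseSet a ∩ L₂.baseSet b),
        μ a i x * L₁.coordChange j i x = L₂.coordChange b a x * μ b j x := by
  obtain ⟨Ψ, hΨ⟩ := h
  refine ⟨fun a i x ↦ Ψ.map a i x 0 0, fun a i ↦ hΨ a i 0 0, fun a i x hx ↦ ?_, fun a b i j x hx ↦ ?_⟩
  · have hu := Ψ.isUnit_map a i x hx
    rw [Matrix.isUnit_iff_isUnit_det, Matrix.det_unique] at hu
    exact hu.ne_zero
  · have hC := Ψ.map_mul_coordChange a b i j x hx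
    have h00 := congrFun (congrFun hC 0) 0
    simpa only [Matrix.mul_apply, Fin.sum_univ_one, HolomorphicLineBundle.toSmoothCocycle_coordChange_apply]
      using h00

/-- **Holomorphically isomorphic line bundles have the same class in `Pic(X) = H¹(Λ, H⁰(𝒪_V^*))`.** If the
rank-one cocycles of two holomorphic line bundles `L₁`, `L₂` on the complex torus `X` (on arbitrary trivialising
covers) are analytically equivalent in the sense of Fritzsche–Grauert IV §2 (C) — units `μ_{a i}` on `U¹_i ∩ U²_a`
with `μ_{a i} g¹ = g² μ_{b j}` — then `φ₁⁻¹(L₁) = φ₁⁻¹(L₂)`: a trivialisation `s` of `L₁ ⊗ L_{f⁻¹}` is carried to the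
trivialisation `μ_{a i} s_{(i,p)}` of `L₂ ⊗ L_{f⁻¹}` (independent of `i` by (C) with `a = b`). This is the junction
between the cocycle language of Serre's GAGA files (`SmoothComplexVectorBundle.AnalyticallyEquivalent`) and the
group `Pic(X)` of Lange §1.2. [cite: Lange2023AbelianVarietiesComplex, §1.2.1 Prop. 1.2.2–1.2.3, p. 21]
[cite: FritzscheGrauert2002, Ch. IV §2 (C)] -/
theorem picClass_eq_of_analyticallyEquivalent
    [IsManifold 𝓘(ℂ, E) ω (ComplexTorus Φ)] [IsManifold 𝓘(ℝ, E) ∞ (ComplexTorus Φ)]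
    {L₁ : HolomorphicLineBundle κ₁ E (ComplexTorus Φ)} {L₂ : HolomorphicLineBundle κ₂ E (ComplexTorus Φ)}
    (h : SmoothComplexVectorBundle.AnalyticallyEquivalent L₁.toSmoothCocycle L₂.toSmoothCocycle) :
    picClass L₁ = picClass L₂ := by
  classical
  obtain ⟨μ, hμ, hμ0, hμC⟩ := exists_units_of_analyticallyEquivalent_toSmoothCocycle h
  obtain ⟨f, hf⟩ := exists_isTrivialOn_tensor_lineBundle_inv L₁
  rw [(picClass_eq_toPic_iff L₁ f).2 hf]
  refine ((picClass_eq_toPic_iff L₂ f).2 ?_).symm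
  obtain ⟨s, hs, hs0, hsg⟩ := hf
  set F := f⁻¹.lineBundle with hF
  choose ix hix using L₁.exists_mem_baseSet
  -- (C) with `a = b`: the candidate section does not depend on the chart of `L₁`
  have hind : ∀ (a : κ₂) (p : ι → ℝ) (i j : κ₁) (x : ComplexTorus Φ), x ∈ L₁.baseSet i → x ∈ L₁.baseSet j →
      x ∈ L₂.baseSet a → x ∈ F.baseSet p → μ a i x * s (i, p) x = μ a j x * s (j, p) x := by
    intro a p i j x hi hj ha hp
    have h1 := hsg (i, p) (j, p) x ⟨⟨⟨hi, hp⟩, hj, hp⟩, mem_univ x⟩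
    have h2 := hμC a a j i x ⟨⟨hj, hi⟩, ha, ha⟩
    rw [L₂.coordChange_self a ha, one_mul] at h2
    rw [h1, HolomorphicLineBundle.tensor_coordChange_apply, F.coordChange_self p hp, mul_one, ← mul_assoc, h2]
  refine ⟨fun q x ↦ μ q.1 (ix x) x * s (ix x, q.2) x, fun q ↦ ?_, fun q x hx ↦ ?_, fun q q' x hx ↦ ?_⟩
  · -- holomorphy: locally the function is `μ_{a i₀} s_{(i₀,p)}` for a fixed chart `i₀`
    intro x₀ hx₀
    obtain ⟨⟨ha, hp⟩, -⟩ := hx₀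
    set i₀ := ix x₀ with hi₀
    have hO : L₁.baseSet i₀ ∈ 𝓝 x₀ := (L₁.isOpen_baseSet i₀).mem_nhds (hix x₀)
    have hg : MDifferentiableOn 𝓘(ℂ, E) 𝓘(ℂ, ℂ) (fun x ↦ μ q.1 i₀ x * s (i₀, q.2) x)
        (((L₂.tensor F).baseSet q ∩ univ) ∩ L₁.baseSet i₀) :=
      ((hμ q.1 i₀).mono fun x hx ↦ ⟨hx.2, hx.1.1.1⟩).mul
        ((hs (i₀, q.2)).mono fun x hx ↦ ⟨⟨hx.2, hx.1.1.2⟩, mem_univ x⟩)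
    have hgx := (mdifferentiableWithinAt_inter hO).1 (hg x₀ ⟨⟨⟨ha, hp⟩, mem_univ _⟩, hix x₀⟩)
    refine hgx.congr_of_eventuallyEq ?_ rfl
    filter_upwards [self_mem_nhdsWithin, mem_nhdsWithin_of_mem_nhds hO] with x hx hxi
    exact hind q.1 q.2 (ix x) i₀ x (hix x) hxi hx.1.1 hx.1.2
  · obtain ⟨⟨ha, hp⟩, -⟩ := hx
    exact mul_ne_zero (hμ0 q.1 (ix x) x ⟨hix x, ha⟩) (hs0 (ix x, q.2) x ⟨⟨hix x, hp⟩, mem_univ x⟩)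
  · obtain ⟨⟨⟨ha, hp⟩, hb, hp'⟩, -⟩ := hx
    set i := ix x with hi
    have h1 := hsg (i, q.2) (i, q'.2) x ⟨⟨⟨hix x, hp⟩, hix x, hp'⟩, mem_univ x⟩
    have h2 := hμC q'.1 q.1 i i x ⟨⟨hix x, hix x⟩, hb, ha⟩
    rw [L₁.coordChange_self i (hix x), mul_one] at h2
    show μ q'.1 i x * s (i, q'.2) x = (L₂.tensor F).coordChange q q' x * (μ q.1 i x * s (i, q.2) x)
    rw [h1, h2, HolomorphicLineBundle.tensor_coordChange_apply, HolomorphicLineBundle.tensor_coordChange_apply,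
      L₁.coordChange_self i (hix x), one_mul]
    ring

end Bridge

/-! ## §2 Translation-invariant classes lie in `Pic⁰(X)` -/

section PicZero

variable {ι : Type*} {E : Type*} [NormedAddCommGroup E] [NormedSpace ℂ E] {Φ : (ι → ℝ) ≃L[ℝ] E}
  [Fintype ι] [DecidableEq ι] [FiniteDimensional ℂ E]

/-- **A class fixed by every translation lies in `Pic⁰(X)`**: if `t_x̄^* x = x` for all `x̄ ∈ X` then
`φ_x ≡ 1`, so by Lemma 1.4.5 (`φ_{L(H,χ)}(π u) = dualToPic (π̂ (φ_H u))`, `dualToPic` injective) the antidual vectors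
`φ_H(u) = H(u, ·)` lie in the dual lattice for EVERY `u ∈ V`; a real-linear map into a lattice is `0`, so `H = 0`,
i.e. `c₁(x) = 0` (Lange §1.4.2 / §2.4: `K(L) = X` iff `H = 0`). [cite: Lange2023AbelianVarietiesComplex, §1.4.2 Lemma 1.4.5 and Prop. 1.4.1] -/
theorem mem_picZero_of_forall_translate_eq {x : Pic Φ} (hx : ∀ t : ComplexTorus Φ, Pic.translate t x = x) :
    x ∈ picZero Φ := by
  obtain ⟨p, rfl⟩ := AHData.toPic_surjective x
  rw [mem_picZero_iff, AHData.nsForm_toPic]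
  -- `φ_H(u)` lies in the dual lattice for every `u`
  have hlat : ∀ u : E, ∃ n : ι → ℤ, phiHFun p.form u = latticeVec (dualPeriod Φ) n := fun u ↦ by
    rw [← cover_eq_zero_iff]
    apply dualToPic_injective Φ
    rw [dualToPic_zero, ← AHData.phiL_toPic_cover, Pic.phiL_apply, hx, mul_inv_cancel]
  -- hence `φ_H(u) = 0`: the coordinates of `φ_H(s • u) = s • φ_H(u)` are integers for all real `s`
  have hzero : ∀ u : E, phiHFun p.form u = 0 := fun u ↦ by
    have hcoord : ∀ s : ℝ, ∃ n : ι → ℤ, s • (dualPeriod Φ).symm (phiHFun p.form u) =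
        fun i ↦ (n i : ℝ) := fun s ↦ by
      obtain ⟨n, hn⟩ := hlat (s • u)
      refine ⟨n, ?_⟩
      have hsm : ((s : ℝ) : ℂ) • phiHFun p.form u = s • phiHFun p.form u := by ext v; simp
      rw [phiHFun_real_smul, hsm] at hn
      rw [← map_smul, hn, latticeVec, ContinuousLinearEquiv.symm_apply_apply]
    suffices h : (dualPeriod Φ).symm (phiHFun p.form u) = 0 by
      simpa using congrArg (dualPeriod Φ) h
    funext i
    obtain ⟨n₁, hn₁⟩ := hcoord 1
    set c := (dualPeriod Φ).symm (phiHFun p.form u) i with hc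
    have h1 : c = n₁ i := by simpa using congrFun hn₁ i
    by_contra hci
    obtain ⟨n₂, hn₂⟩ := hcoord (1 / (2 * c))
    have h2 : (1 / (2 * c)) * c = n₂ i := by simpa using congrFun hn₂ i
    rw [one_div_mul_eq_div, div_mul_cancel_right₀ hci] at h2
    -- `1/2 = n₂ i` with `n₂ i ∈ ℤ`: impossible
    have h3 : (2 : ℝ) * n₂ i = 1 := by rw [← h2]; norm_num
    have h4 : (2 * n₂ i : ℤ) = 1 := by exact_mod_cast h3
    omega
  -- and `H = 0` means the alternating form vanishes
  ext v
  have hv : v = ![v 0, v 1] := by ext i; fin_cases i <;> rfl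
  have h := congrArg (fun ℓ : E →L⋆[ℂ] ℂ ↦ (ℓ (v 1)).im) (hzero (v 0))
  rw [hv]
  simpa [phiHFun, antidualOfIm, antidualOfImFun, twoFormLeft] using h

end PicZero

/-! ## §3 The class `[𝒪_X(D)^an] ∈ Pic(X)` of a Cartier divisor on a scheme analytified by a complex torus -/

section Divisors

variable {ι : Type} {E : Type} [NormedAddCommGroup E] [NormedSpace ℂ E] {Φ : (ι → ℝ) ≃L[ℝ] E}
  [Fintype ι] [FiniteDimensional ℂ E]
  {X : SchemeOver ℂ} [AlgebraicGeometry.IsIntegral X.left] {n : ℕ}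
  {φ : ComplexTorus Φ → ComplexPoints X} (hφ : IsAnalytification E X n φ)

/-- **Linearly equivalent divisors have the same class `[𝒪_X(D)^an] ∈ Pic(X)`** (`D ∼ D'` gives a holomorphic
isomorphism `𝒪(D)^an ≅ 𝒪(D')^an`, `analyticallyEquivalent_cartierDivisorCocycle_of_isUnitAt`, and §1).
[cite: GortzWedhorn2020, Prop. 11.21 (p. 374)] [cite: Lange2023AbelianVarietiesComplex, §1.2.1 Prop. 1.2.2, p. 21] -/
theorem picClass_cartierDivisorLineBundle_eq_of_linEquiv {D D' : CartierDivisor X.left} (h : D.LinEquiv D') :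
    picClass (cartierDivisorLineBundle hφ D) =
      picClass (cartierDivisorLineBundle hφ D') := by
  obtain ⟨g, -, H⟩ := (CartierDivisor.linEquiv_iff D D').1 h
  exact picClass_eq_of_analyticallyEquivalent
    (analyticallyEquivalent_cartierDivisorCocycle_of_isUnitAt hφ D D' g H)

/-- **`[𝒪_X(D + D')^an] = [𝒪_X(D)^an] · [𝒪_X(D')^an]`** in `Pic(X)` (`𝒪(D + D')^an ≅ 𝒪(D)^an ⊗ 𝒪(D')^an`,
`analyticallyEquivalent_cartierDivisorCocycle_add`, §1 and `picClass_tensor`).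
[cite: GortzWedhorn2020, Prop. 11.21 (p. 374)] [cite: Lange2023AbelianVarietiesComplex, §1.2.1 Prop. 1.2.2, p. 21] -/
theorem picClass_cartierDivisorLineBundle_add (D D' : CartierDivisor X.left) :
    picClass (cartierDivisorLineBundle hφ (D + D')) =
      picClass (cartierDivisorLineBundle hφ D) *
        picClass (cartierDivisorLineBundle hφ D') := by
  rw [← picClass_tensor]
  exact picClass_eq_of_analyticallyEquivalent
    (analyticallyEquivalent_cartierDivisorCocycle_add hφ D D')

/-- **`[𝒪_X(0)^an] = 1`**: the zero divisor `(X, 1)` has the nowhere-vanishing frame `1`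
(`cartierDivisorLineBundle_isTrivialOn_nonvanishing_one`). [cite: Lange2023AbelianVarietiesComplex, §1.2.1 Prop. 1.2.2, p. 21] -/
theorem picClass_cartierDivisorLineBundle_zero :
    picClass (cartierDivisorLineBundle hφ (0 : CartierDivisor X.left)) = 1 := by
  refine picClass_eq_one_of_isTrivialOn
    ((cartierDivisorLineBundle_isTrivialOn_nonvanishing_one hφ 0).mono ?_)
  rintro m -
  obtain ⟨i, hi⟩ := (0 : CartierDivisor X.left).covers (φ m).pt
  refine ⟨i, hi, ?_⟩
  rw [CartierDivisor.zero_f, one_mul]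
  exact RatFn.isUnitAt_one

/-- **`[𝒪_X(-D)^an] = [𝒪_X(D)^an]⁻¹`** (`D + (-D)` presents the zero divisor). [cite: GortzWedhorn2020, Prop. 11.21 (p. 374)] -/
theorem picClass_cartierDivisorLineBundle_neg (D : CartierDivisor X.left) :
    picClass (cartierDivisorLineBundle hφ (-D)) =
      (picClass (cartierDivisorLineBundle hφ D))⁻¹ := by
  rw [eq_inv_iff_mul_eq_one, mul_comm, ← picClass_cartierDivisorLineBundle_add hφ,
    picClass_cartierDivisorLineBundle_eq_of_linEquiv hφ (CartierDivisor.add_neg_sameDivisor D).linEquiv,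
    picClass_cartierDivisorLineBundle_zero hφ]

end Divisors

/-! ## §4 Uniformised complex abelian varieties: algebraic translations act on `Pic(X)` by `Pic.translate` -/

section AbelianVariety

open AlgebraicGeometry

/-- Two holomorphic line bundles with the same trivialising sets and the same transition functions are equal
(the remaining fields are propositions). [folklore] -/
private theorem holomorphicLineBundle_ext_of_baseSet_coordChange
    {κ : Type*} {E : Type*} [NormedAddCommGroup E] [NormedSpace ℂ E] {M : Type*} [TopologicalSpace M]
    [ChartedSpace E M] {L L' : HolomorphicLineBundle κ E M} (h₁ : L.baseSet = L'.baseSet)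
    (h₂ : L.coordChange = L'.coordChange) : L = L' := by
  cases L; cases L'; cases h₁; cases h₂; rfl

variable {ι : Type} [Fintype ι] [DecidableEq ι] (A : AbelianVariety ℂ) {Φ : (ι → ℝ) ≃L[ℝ] (Fin A.dim → ℂ)}
  {φ : ComplexTorus Φ → ComplexPoints A.X} (hφ : IsAnalytification (Fin A.dim → ℂ) A.X A.dim φ)
  (hadd : ∀ x y, φ (x + y) = φ x * φ y)

include hadd

omit [Fintype ι] [DecidableEq ι] in
/-- Under a uniformisation `φ : V/Λ → A(ℂ)` compatible with the group laws (as in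
`HodgeTheory.complexAbelianVariety_torusUniformised`), the algebraic translation `t_{φ(t̄)}` acts on complex points
as the translation `s̄ ↦ s̄ + t̄` of the torus: `φ(s̄) ≫ t_{φ(t̄)} = φ(t̄) · φ(s̄) = φ(s̄ + t̄)`.
[cite: GortzWedhorn2023, Def. 27.1 (p. 799)] -/
theorem map_translation_uniformisation (t s : ComplexTorus Φ) :
    AlgPoints.map (A.translation (φ t)) (φ s) = φ (s + t) := by
  rw [AlgPoints.map_apply, AbelianVariety.comp_translation, hadd, mul_comm]

omit [DecidableEq ι] in
/-- **`𝒪_A(t_x^* D)^an = (t^an)^* 𝒪_A(D)^an` on the nose** for `x = φ(t̄)`: the analytified cocycle of the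
translated divisor `t_x^* D = (t_x⁻¹ U_i, t_x^♯ f_i)` IS the pull-back of the cocycle of `D` along the torus
translation `s̄ ↦ s̄ + t̄` — same trivialising sets (`φ(s̄) ∈ t_x⁻¹U_i ⟺ φ(s̄ + t̄) ∈ U_i`) and same transition
functions (`CartierDivisor.evalOrZero_transFun_pullback`). [cite: GortzWedhorn2020, Def. 11.49 and Prop. 11.50 (p. 392)] -/
theorem cartierDivisorLineBundle_pullback_translation (D : CartierDivisor A.X.left) (t : ComplexTorus Φ) :
    cartierDivisorLineBundle hφ (D.pullback (A.translation (φ t)).left) =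
      (cartierDivisorLineBundle hφ D).pullback (fun s ↦ s + t) (mdifferentiable_add_const Φ t) := by
  refine holomorphicLineBundle_ext_of_baseSet_coordChange ?_ ?_
  · funext i
    ext s
    show (A.translation (φ t)).left (φ s).pt ∈ D.U i ↔ (φ (s + t)).pt ∈ D.U i
    rw [← map_translation_uniformisation A hadd t s, AlgPoints.pt_map]
  · funext i j s
    show AlgPoints.evalOrZero ((D.pullback (A.translation (φ t)).left).U j ⊓ (D.pullback (A.translation (φ t)).left).U i)
        ((D.pullback (A.translation (φ t)).left).transFun j i) (φ s) =
      AlgPoints.evalOrZero (D.U j ⊓ D.U i) (D.transFun j i) (φ (s + t))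
    rw [CartierDivisor.evalOrZero_transFun_pullback, map_translation_uniformisation A hadd]

omit [DecidableEq ι] in
/-- **Algebraic translation = `Pic.translate` under the uniformisation**: for every Cartier divisor `D` on `A` and
every point `t̄` of the torus, `[𝒪_A(t_{φ(t̄)}^* D)^an] = t_t̄^* [𝒪_A(D)^an]` in `Pic(X)` (Lange §1.3.3, Lemma 1.3.4,
`picClass_pullback_add_cover`). [cite: Lange2023AbelianVarietiesComplex, §1.3.3 Lemma 1.3.4, p. 31]
[cite: GortzWedhorn2020, Prop. 11.50 (p. 392)] -/
theorem picClass_cartierDivisorLineBundle_pullback_translation (D : CartierDivisor A.X.left) (t : ComplexTorus Φ) :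
    picClass (cartierDivisorLineBundle hφ (D.pullback (A.translation (φ t)).left)) =
      Pic.translate t (picClass (cartierDivisorLineBundle hφ D)) := by
  obtain ⟨u, rfl⟩ : ∃ u, cover Φ u = t := ⟨_, cover_apply_lift t⟩
  rw [cartierDivisorLineBundle_pullback_translation A hφ hadd]
  exact picClass_pullback_add_cover _ u _

omit [DecidableEq ι] in
/-- The same with the translation indexed by a complex point `x ∈ A(ℂ)`: `[𝒪_A(t_x^* D)^an] = t_{φ⁻¹(x)}^* [𝒪_A(D)^an]`.
[cite: Lange2023AbelianVarietiesComplex, §1.3.3 Lemma 1.3.4, p. 31] -/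
theorem picClass_cartierDivisorLineBundle_pullback_translation_point (D : CartierDivisor A.X.left) (x : A.Points ℂ) :
    picClass (cartierDivisorLineBundle hφ (D.pullback (A.translation x).left)) =
      Pic.translate (hφ.homeomorph.symm x) (picClass (cartierDivisorLineBundle hφ D)) := by
  have hx : φ (hφ.homeomorph.symm x) = x := hφ.homeomorph.apply_symm_apply x
  conv_lhs => rw [← hx]
  exact picClass_cartierDivisorLineBundle_pullback_translation A hφ hadd D _

omit [DecidableEq ι] in
/-- **`[𝒪_A(D_x)^an] = φ_{[𝒪_A(Θ)^an]}(φ⁻¹ x)`** for the divisor `D_x = t_x^*Θ − Θ` of `φ_Θ(x)`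
(`AbelianVariety.weilDiv`): the algebraic `φ_Θ` of [MumfordAV1970, §8] IS Lange's analytic `φ_L` (§1.4.2) read
through the uniformisation. [cite: Lange2023AbelianVarietiesComplex, §1.4.2, display before Lemma 1.4.5]
[cite: MumfordAV1970, §8 (definition of φ_L)] -/
theorem picClass_cartierDivisorLineBundle_weilDiv (Θ : CartierDivisor A.X.left) (t : ComplexTorus Φ) :
    picClass (cartierDivisorLineBundle hφ (A.weilDiv Θ (φ t))) =
      Pic.phiL (picClass (cartierDivisorLineBundle hφ Θ)) t := by
  rw [AbelianVariety.weilDiv, picClass_cartierDivisorLineBundle_add hφ, picClass_cartierDivisorLineBundle_neg hφ,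
    picClass_cartierDivisorLineBundle_pullback_translation A hφ hadd, Pic.phiL_apply]

/-- **A translation-invariant divisor class analytifies into `Pic⁰`**: if `t_x^* D ∼ D` for every complex point
`x ∈ A(ℂ)` (Mumford's `K(D) = A`, i.e. `𝒪(D) ∈ Pic⁰(A)` by [MumfordAV1970, §8 (iv) ⇒ (i)]), then the class of
`𝒪_A(D)^an` on the uniformising torus is fixed by every `t_t̄^*`, hence has first Chern class `0`
(`mem_picZero_of_forall_translate_eq`). [cite: MumfordAV1970, §8 ((iv) ⇒ (i))]
[cite: Lange2023AbelianVarietiesComplex, §1.4.1 Prop. 1.4.1 and §1.4.2] -/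
theorem picClass_cartierDivisorLineBundle_mem_picZero (D : CartierDivisor A.X.left)
    (hD : ∀ x : A.Points ℂ, (D.pullback (A.translation x).left).LinEquiv D) :
    picClass (cartierDivisorLineBundle hφ D) ∈ picZero Φ := by
  refine mem_picZero_of_forall_translate_eq fun t ↦ ?_
  rw [← picClass_cartierDivisorLineBundle_pullback_translation A hφ hadd D t]
  exact picClass_cartierDivisorLineBundle_eq_of_linEquiv hφ (hD (φ t))

/-- … hence **it is the class `dualToPic s` of a point `s` of the dual torus `X̂`** (`Pic⁰(X) = X̂`, Lange Prop. 1.4.1).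
[cite: Lange2023AbelianVarietiesComplex, §1.4.1 Prop. 1.4.1] -/
theorem exists_dualToPic_eq_picClass_cartierDivisorLineBundle (D : CartierDivisor A.X.left)
    (hD : ∀ x : A.Points ℂ, (D.pullback (A.translation x).left).LinEquiv D) :
    ∃ s : Dual Φ, dualToPic Φ s = picClass (cartierDivisorLineBundle hφ D) :=
  exists_dualToPic_eq_of_mem_picZero Φ (picClass_cartierDivisorLineBundle_mem_picZero A hφ hadd D hD)

end AbelianVariety

end Literature.AlgebraicGeometry.HodgeTheory

end
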